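import Summits.QuantumFields.BalabanUV.Beta.GAN24.WoodburyFibreGaugeDecay

/-!
# Beta / GAN24 / WoodburyFibreGaugeCubeDecay — the fibre-correction bound in the CUBE (`ℓ∞`-operator) currency:
`N`-SHARP constants for the decay of the Landau-gauge scalar operator `Γ·coproj ℋ·Γ` (census row V9, part 1′)

Cell `pub-balaban`, β sub-cell, BINDER ROW **G-an2-4 ∕ (CONV-C)** («NOT IN PRINT; our proof attempt»), prover part **P3 =
WOODBURY-FIBRE reduction** (lineage `b2b-balaban-gan24-p3`, gen 5).  HONEST FRAMING (verbatim): discharging `BetaPertH`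
makes Bałaban's UV stability UNCONDITIONAL — a real constructive-QFT result; it is NOT the continuum limit and NOT the Clay
problem.  HONEST DEPENDENCY: continuum YM on T⁴ ⇐ BetaPertH ∧ nine spine estimates (0/9 proved); BetaPertH ⇐ (D1) ∧ (D4) ∧
CAP+tail; G-an2-4 gates asym, D1 and NE2/3/4.  `[folklore]` bookkeeping; 0 sorry; nothing of (CONV-C) ∕ `BetaPertH` discharged.

## Why a second currency (honest correction of the READING in `GAN24/WoodburyFibreGaugeDecay`)

`WoodburyFibreGaugeDecay.posDecay_sandwich_coproj` bounds `Γ·coproj ℋ·Γ` ENTRYWISE (`PosDecay`: `|A(x,y)| ≤ c e^{−δ d}`) and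
sums over FINE sites with the fine profile `K₁ ≍ N^{dim}`.  For a fine-level covariance in dimension ≥ 3 the entrywise
constant is governed by the SHORT-DISTANCE singularity (`|Γ(x,y)| ≍ N^{−2}|x−y|^{2−dim}` near the diagonal in King's
normalisation), so «`cΓ ≍ N^{−d}`» in that docstring is NOT the right reading there: fed with sharp entrywise inputs the
theorem stays true and `N`-uniform but loses powers of `N` against the natural size.  Bałaban's own currency for
fine-level kernels is the cube-localised operator bound `|(GJ)(x)| ≤ O(1)e^{−δ₀|y−y′|}|J|`, `supp J ⊂ Δ(y′)` [B5 (1.110)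
p.35], i.e. ROW SUMS OVER UNIT CUBES.  This file redoes the assembly in that currency, where every constant has its
natural size and only the BLOCK profile `K` (N-free) enters:
* `CubeDecay blk σ A c δ` : `∀ x b′, Σ_{y ∈ b′} |A(x,y)| ≤ c·e^{−δ·dX(σ(blk x), σ b′)}` (fine × fine; `ℓ∞`-operator norm
  between cubes); `ColCubeDecay blk σ H c δ` : `∀ b b′, Σ_{y ∈ b′} |H(y,b)| ≤ c·e^{−δ·dX(σ b′, σ b)}` (fine × block, read
  along fine columns); fine × block kernels read entrywise are `PosDecay dX (σ ∘ blk) σ H c δ` (tree).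
* §2 composition lemmas (each = triangle inequality + the block profile, as `B5Decay126.PosDecay.mul`):
  `CubeDecay.mul` (fine·fine), `CubeDecay.mul_posDecay` (fine·(fine×block)), `posDecay_mul_colCube`
  ((fine×block)·(block×fine) → cube), `gram_posDecay` (`ℋᴴℋ` entrywise from `PosDecay ℋ` × `ColCubeDecay ℋ`), `CubeDecay.sub`.
* §3 **`cubeDecay_sandwich_coproj`**: `CubeDecay Γ cΓ δ`, `PosDecay ℋ cH δ`, `ColCubeDecay ℋ cH′ δ`, `Coercive (ℋᴴℋ) γ` ⟹
  `CubeDecay (Γ·coproj ℋ·Γ)` at rate `δ₁/8` (`δ₁ = rate K γ (cH·cH′·K(δ/2)) (δ/2)`) with constant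
  `cΓ²K(δ/2) + cΓ·cH·K(δ/2)·(2/γ)·K(δ₁/2)·cH′·K(δ₁/4)·cΓ·K(δ₁/8)`.  N-READING (King's normalisation, `N^{dim}` sites per
  block): `cΓ ≍ 1` (row sums of a covariance), `cH ≍ 1`, `cH′ ≍ N^{dim}` (a column of `ℋ` summed over a cube), `γ = N^{dim}`
  (`gram_minimiser_form_ge`, `QQᴴ = N^{−dim}`), `K ≍ 1`: the constant is `≍ 1 + N^{dim}·N^{−dim} = O(1)` = the natural size of
  `Σ_{y∈b′}|Sb(x,y)|`, and `δ₁` is `N`-free by `WoodburyFibreGaugeDecay.rate_mono_scale`.  **`cubeDecay_flucCov_sq`**: transported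
  to `flucCov (L·L + QᴴT₂Q) Q` by R17.
NOT here: the inputs themselves (fine-level cube decay of King's scalar `Γ`, `ℋ` — census V9 part 2, dictionary to
`B4Thm110ZeroBox` ∕ `B4Torus248Decay` ∕ `B5Hk103ScalarZd`).
-/

namespace Summit.QuantumFields.BalabanUV.Beta.GAN24.WoodburyFibreGaugeCubeDecay

open Matrix Finset
open Literature.MathematicalPhysics.QuantumFieldTheory.Balaban1983to89
open B4Sect5Torus (IsPseudoDist rate)
open B5Decay126 (PosDecay PosProfile)
open Summit.QuantumFields.BalabanUV.Beta.PropagatorWoodburyFibre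
open Summit.QuantumFields.BalabanUV.Beta.GAN24.WoodburyFibreGaugeSection
open Summit.QuantumFields.BalabanUV.Beta.GAN24.WoodburyFibreGaugeDecay

noncomputable section

variable {X : Type*} {dX : X → X → ℝ}
variable {ι κ : Type*} [Fintype ι] [Fintype κ] [DecidableEq ι] [DecidableEq κ]

/-! ## §1 The cube currencies -/

/-- [shape] `CubeDecay dX blk σ A c δ`: cube-to-cube `ℓ∞`-operator decay of a fine × fine kernel — every row of `A`, summed in
absolute value over the fine sites of the block `b′`, is `≤ c·e^{−δ·dX(block of the row, b′)}`. [folklore] -/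
def CubeDecay (dX : X → X → ℝ) (blk : ι → κ) (σ : κ → X) (A : Matrix ι ι ℝ) (c δ : ℝ) : Prop :=
  0 ≤ c ∧ ∀ x b', ∑ y ∈ univ.filter (fun y => blk y = b'), |A x y| ≤ c * Real.exp (-(δ * dX (σ (blk x)) (σ b')))

/-- [shape] `ColCubeDecay dX blk σ H c δ`: a fine × block kernel read along its fine index, summed over a cube:
`Σ_{y ∈ b′} |H(y,b)| ≤ c·e^{−δ·dX(σ b′, σ b)}` (the rows of `ℋᴴ` in the cube currency). [folklore] -/
def ColCubeDecay (dX : X → X → ℝ) (blk : ι → κ) (σ : κ → X) (H : Matrix ι κ ℝ) (c δ : ℝ) : Prop :=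
  0 ≤ c ∧ ∀ b b', ∑ y ∈ univ.filter (fun y => blk y = b'), |H y b| ≤ c * Real.exp (-(δ * dX (σ b') (σ b)))

variable {blk : ι → κ} {σ : κ → X} {K : ℝ → ℝ}

omit [Fintype κ] [DecidableEq ι] in
/-- Weakening the rate of a cube decay. [folklore] -/
theorem CubeDecay.mono (hd : IsPseudoDist dX) {A : Matrix ι ι ℝ} {c δ δ' : ℝ} (h : CubeDecay dX blk σ A c δ)
    (hδ' : δ' ≤ δ) : CubeDecay dX blk σ A c δ' := by
  refine ⟨h.1, fun x b' => (h.2 x b').trans (mul_le_mul_of_nonneg_left ?_ h.1)⟩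
  exact Real.exp_le_exp.mpr (by nlinarith [hd.nonneg (σ (blk x)) (σ b')])

omit [Fintype κ] [DecidableEq ι] in
/-- Difference of two cube-decaying kernels. [folklore] -/
theorem CubeDecay.sub (hd : IsPseudoDist dX) {A B : Matrix ι ι ℝ} {c₁ c₂ δ₁ δ₂ δ : ℝ}
    (hA : CubeDecay dX blk σ A c₁ δ₁) (hB : CubeDecay dX blk σ B c₂ δ₂) (h₁ : δ ≤ δ₁) (h₂ : δ ≤ δ₂) :
    CubeDecay dX blk σ (A - B) (c₁ + c₂) δ := by
  have hA' := hA.mono hd h₁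
  have hB' := hB.mono hd h₂
  refine ⟨add_nonneg hA.1 hB.1, fun x b' => ?_⟩
  calc ∑ y ∈ univ.filter (fun y => blk y = b'), |(A - B) x y|
      ≤ ∑ y ∈ univ.filter (fun y => blk y = b'), (|A x y| + |B x y|) :=
        sum_le_sum fun y _ => by rw [Matrix.sub_apply]; exact abs_sub _ _
    _ ≤ c₁ * Real.exp (-(δ * dX (σ (blk x)) (σ b'))) + c₂ * Real.exp (-(δ * dX (σ (blk x)) (σ b'))) := by
        rw [sum_add_distrib]; exact add_le_add (hA'.2 x b') (hB'.2 x b')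
    _ = (c₁ + c₂) * Real.exp (-(δ * dX (σ (blk x)) (σ b'))) := by ring

/-- The elementary two-leg estimate behind every composition below: for nonnegative distances obeying the triangle
inequality, `e^{−δa·d₁}·e^{−δb·d₂} ≤ e^{−δ′·d₁₃}·e^{−g·d₁}` when `δ′ + g ≤ δa, δb` and `d₁₃ ≤ d₁ + d₂`. [folklore] -/
theorem exp_two_legs {d₁ d₂ d₁₃ δa δb δ' g : ℝ} (h1 : 0 ≤ d₁) (h2 : 0 ≤ d₂) (htri : d₁₃ ≤ d₁ + d₂) (hδ' : 0 ≤ δ')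
    (hg : 0 < g) (hga : δ' + g ≤ δa) (hgb : δ' + g ≤ δb) :
    Real.exp (-(δa * d₁)) * Real.exp (-(δb * d₂)) ≤ Real.exp (-(δ' * d₁₃)) * Real.exp (-(g * d₁)) := by
  rw [← Real.exp_add, ← Real.exp_add]
  apply Real.exp_le_exp.mpr
  have h3 : δ' * d₁₃ ≤ δ' * (d₁ + d₂) := mul_le_mul_of_nonneg_left htri hδ'
  nlinarith [mul_le_mul_of_nonneg_right hga h1, mul_le_mul_of_nonneg_right hgb h2, mul_nonneg hg.le h2]

/-! ## §2 Composition in the cube currency -/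

omit [DecidableEq ι] in
/-- **fine · fine**: `CubeDecay A ∧ CubeDecay B ⇒ CubeDecay (A·B)` with constant `c₁c₂K(g)`. [folklore] -/
theorem CubeDecay.mul (hd : IsPseudoDist dX) (hK0 : ∀ t, 0 < t → 0 ≤ K t) (hK : PosProfile dX σ K)
    {A B : Matrix ι ι ℝ} {c₁ c₂ δa δb : ℝ} (hA : CubeDecay dX blk σ A c₁ δa) (hB : CubeDecay dX blk σ B c₂ δb)
    {δ' g : ℝ} (hδ' : 0 ≤ δ') (hg : 0 < g) (hga : δ' + g ≤ δa) (hgb : δ' + g ≤ δb) :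
    CubeDecay dX blk σ (A * B) (c₁ * c₂ * K g) δ' := by
  refine ⟨mul_nonneg (mul_nonneg hA.1 hB.1) (hK0 g hg), fun x b' => ?_⟩
  set E : ℝ := Real.exp (-(δ' * dX (σ (blk x)) (σ b'))) with hE
  -- Σ_{y∈b'} |(AB)(x,y)| ≤ Σ_z |A x z| Σ_{y∈b'} |B z y|
  have step1 : ∑ y ∈ univ.filter (fun y => blk y = b'), |(A * B) x y|
      ≤ ∑ z, |A x z| * ∑ y ∈ univ.filter (fun y => blk y = b'), |B z y| := by
    calc ∑ y ∈ univ.filter (fun y => blk y = b'), |(A * B) x y|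
        ≤ ∑ y ∈ univ.filter (fun y => blk y = b'), ∑ z, |A x z| * |B z y| :=
          sum_le_sum fun y _ => by
            rw [Matrix.mul_apply]
            exact (abs_sum_le_sum_abs _ _).trans (le_of_eq (sum_congr rfl fun z _ => abs_mul _ _))
      _ = ∑ z, |A x z| * ∑ y ∈ univ.filter (fun y => blk y = b'), |B z y| := by
          rw [sum_comm]; exact sum_congr rfl fun z _ => by rw [mul_sum]
  -- regroup the z-sum by blocks and use the two decays
  have step2 : ∑ z, |A x z| * ∑ y ∈ univ.filter (fun y => blk y = b'), |B z y|
      ≤ ∑ b'', (∑ z ∈ univ.filter (fun z => blk z = b''), |A x z|) * (c₂ * Real.exp (-(δb * dX (σ b'') (σ b')))) := by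
    rw [← Finset.sum_fiberwise univ blk]
    refine sum_le_sum fun b'' _ => ?_
    rw [sum_mul]
    refine sum_le_sum fun z hz => ?_
    have hzb : blk z = b'' := (mem_filter.mp hz).2
    rw [← hzb]
    exact mul_le_mul_of_nonneg_left (hB.2 z b') (abs_nonneg _)
  have step3 : ∑ b'', (∑ z ∈ univ.filter (fun z => blk z = b''), |A x z|) * (c₂ * Real.exp (-(δb * dX (σ b'') (σ b'))))
      ≤ ∑ b'', c₁ * c₂ * E * Real.exp (-(g * dX (σ (blk x)) (σ b''))) := by
    refine sum_le_sum fun b'' _ => ?_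
    calc (∑ z ∈ univ.filter (fun z => blk z = b''), |A x z|) * (c₂ * Real.exp (-(δb * dX (σ b'') (σ b'))))
        ≤ (c₁ * Real.exp (-(δa * dX (σ (blk x)) (σ b'')))) * (c₂ * Real.exp (-(δb * dX (σ b'') (σ b')))) :=
          mul_le_mul_of_nonneg_right (hA.2 x b'') (mul_nonneg hB.1 (Real.exp_pos _).le)
      _ = c₁ * c₂ * (Real.exp (-(δa * dX (σ (blk x)) (σ b''))) * Real.exp (-(δb * dX (σ b'') (σ b')))) := by ring
      _ ≤ c₁ * c₂ * (E * Real.exp (-(g * dX (σ (blk x)) (σ b'')))) :=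
          mul_le_mul_of_nonneg_left
            (exp_two_legs (hd.nonneg _ _) (hd.nonneg _ _) (hd.triangle _ _ _) hδ' hg hga hgb) (mul_nonneg hA.1 hB.1)
      _ = c₁ * c₂ * E * Real.exp (-(g * dX (σ (blk x)) (σ b''))) := by ring
  calc ∑ y ∈ univ.filter (fun y => blk y = b'), |(A * B) x y|
      ≤ ∑ b'', c₁ * c₂ * E * Real.exp (-(g * dX (σ (blk x)) (σ b''))) := step1.trans (step2.trans step3)
    _ = c₁ * c₂ * E * ∑ b'', Real.exp (-(g * dX (σ (blk x)) (σ b''))) := by rw [mul_sum]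
    _ ≤ c₁ * c₂ * E * K g :=
        mul_le_mul_of_nonneg_left (hK g hg _) (mul_nonneg (mul_nonneg hA.1 hB.1) (Real.exp_pos _).le)
    _ = c₁ * c₂ * K g * E := by ring

omit [DecidableEq ι] in
/-- **fine · (fine × block)**: `CubeDecay A ∧ PosDecay H ⇒ PosDecay (A·H)` (entrywise) with constant `c₁c₂K(g)`. [folklore] -/
theorem CubeDecay.mul_posDecay (hd : IsPseudoDist dX) (hK0 : ∀ t, 0 < t → 0 ≤ K t) (hK : PosProfile dX σ K)
    {A : Matrix ι ι ℝ} {H : Matrix ι κ ℝ} {c₁ c₂ δa δb : ℝ} (hA : CubeDecay dX blk σ A c₁ δa)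
    (hH : PosDecay dX (σ ∘ blk) σ H c₂ δb) {δ' g : ℝ} (hδ' : 0 ≤ δ') (hg : 0 < g) (hga : δ' + g ≤ δa)
    (hgb : δ' + g ≤ δb) : PosDecay dX (σ ∘ blk) σ (A * H) (c₁ * c₂ * K g) δ' := by
  refine ⟨mul_nonneg (mul_nonneg hA.1 hH.1) (hK0 g hg), fun x b => ?_⟩
  set E : ℝ := Real.exp (-(δ' * dX ((σ ∘ blk) x) (σ b))) with hE
  have step1 : |(A * H) x b| ≤ ∑ b'', (∑ z ∈ univ.filter (fun z => blk z = b''), |A x z|)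
      * (c₂ * Real.exp (-(δb * dX (σ b'') (σ b)))) := by
    rw [Matrix.mul_apply]
    refine (abs_sum_le_sum_abs _ _).trans ?_
    rw [← Finset.sum_fiberwise univ blk]
    refine sum_le_sum fun b'' _ => ?_
    rw [sum_mul]
    refine sum_le_sum fun z hz => ?_
    have hzb : blk z = b'' := (mem_filter.mp hz).2
    rw [abs_mul, ← hzb]
    exact mul_le_mul_of_nonneg_left (hH.2 z b) (abs_nonneg _)
  calc |(A * H) x b|
      ≤ ∑ b'', (∑ z ∈ univ.filter (fun z => blk z = b''), |A x z|) * (c₂ * Real.exp (-(δb * dX (σ b'') (σ b)))) := step1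
    _ ≤ ∑ b'', c₁ * c₂ * E * Real.exp (-(g * dX (σ (blk x)) (σ b''))) := by
        refine sum_le_sum fun b'' _ => ?_
        calc (∑ z ∈ univ.filter (fun z => blk z = b''), |A x z|) * (c₂ * Real.exp (-(δb * dX (σ b'') (σ b))))
            ≤ (c₁ * Real.exp (-(δa * dX (σ (blk x)) (σ b'')))) * (c₂ * Real.exp (-(δb * dX (σ b'') (σ b)))) :=
              mul_le_mul_of_nonneg_right (hA.2 x b'') (mul_nonneg hH.1 (Real.exp_pos _).le)
          _ = c₁ * c₂ * (Real.exp (-(δa * dX (σ (blk x)) (σ b''))) * Real.exp (-(δb * dX (σ b'') (σ b)))) := by ring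
          _ ≤ c₁ * c₂ * (E * Real.exp (-(g * dX (σ (blk x)) (σ b'')))) :=
              mul_le_mul_of_nonneg_left
                (exp_two_legs (hd.nonneg _ _) (hd.nonneg _ _) (hd.triangle _ _ _) hδ' hg hga hgb) (mul_nonneg hA.1 hH.1)
          _ = c₁ * c₂ * E * Real.exp (-(g * dX (σ (blk x)) (σ b''))) := by ring
    _ = c₁ * c₂ * E * ∑ b'', Real.exp (-(g * dX (σ (blk x)) (σ b''))) := by rw [mul_sum]
    _ ≤ c₁ * c₂ * E * K g :=
        mul_le_mul_of_nonneg_left (hK g hg _) (mul_nonneg (mul_nonneg hA.1 hH.1) (Real.exp_pos _).le)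
    _ = c₁ * c₂ * K g * E := by ring

omit [DecidableEq ι] in
/-- **(fine × block) · (block × fine) → cube**: `PosDecay T ∧ ColCubeDecay H ⇒ CubeDecay (T·Hᴴ)`, constant `c₁c₂K(g)`.
[folklore] -/
theorem posDecay_mul_colCube (hd : IsPseudoDist dX) (hK0 : ∀ t, 0 < t → 0 ≤ K t) (hK : PosProfile dX σ K)
    {T H : Matrix ι κ ℝ} {c₁ c₂ δa δb : ℝ} (hT : PosDecay dX (σ ∘ blk) σ T c₁ δa) (hH : ColCubeDecay dX blk σ H c₂ δb)
    {δ' g : ℝ} (hδ' : 0 ≤ δ') (hg : 0 < g) (hga : δ' + g ≤ δa) (hgb : δ' + g ≤ δb) :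
    CubeDecay dX blk σ (T * Hᴴ) (c₁ * c₂ * K g) δ' := by
  refine ⟨mul_nonneg (mul_nonneg hT.1 hH.1) (hK0 g hg), fun x b' => ?_⟩
  set E : ℝ := Real.exp (-(δ' * dX (σ (blk x)) (σ b'))) with hE
  have step1 : ∑ y ∈ univ.filter (fun y => blk y = b'), |(T * Hᴴ) x y|
      ≤ ∑ b'', |T x b''| * ∑ y ∈ univ.filter (fun y => blk y = b'), |H y b''| := by
    calc ∑ y ∈ univ.filter (fun y => blk y = b'), |(T * Hᴴ) x y|
        ≤ ∑ y ∈ univ.filter (fun y => blk y = b'), ∑ b'', |T x b''| * |H y b''| :=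
          sum_le_sum fun y _ => by
            rw [Matrix.mul_apply]
            refine (abs_sum_le_sum_abs _ _).trans (le_of_eq (sum_congr rfl fun b'' _ => ?_))
            rw [conjTranspose_apply, star_trivial, abs_mul]
      _ = ∑ b'', |T x b''| * ∑ y ∈ univ.filter (fun y => blk y = b'), |H y b''| := by
          rw [sum_comm]; exact sum_congr rfl fun b'' _ => by rw [mul_sum]
  calc ∑ y ∈ univ.filter (fun y => blk y = b'), |(T * Hᴴ) x y|
      ≤ ∑ b'', |T x b''| * ∑ y ∈ univ.filter (fun y => blk y = b'), |H y b''| := step1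
    _ ≤ ∑ b'', c₁ * c₂ * E * Real.exp (-(g * dX (σ (blk x)) (σ b''))) := by
        refine sum_le_sum fun b'' _ => ?_
        calc |T x b''| * ∑ y ∈ univ.filter (fun y => blk y = b'), |H y b''|
            ≤ (c₁ * Real.exp (-(δa * dX (σ (blk x)) (σ b'')))) * (c₂ * Real.exp (-(δb * dX (σ b') (σ b'')))) :=
              mul_le_mul (hT.2 x b'') (hH.2 b'' b') (sum_nonneg fun _ _ => abs_nonneg _)
                (mul_nonneg hT.1 (Real.exp_pos _).le)
          _ = c₁ * c₂ * (Real.exp (-(δa * dX (σ (blk x)) (σ b''))) * Real.exp (-(δb * dX (σ b'') (σ b')))) := by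
              rw [hd.symm (σ b') (σ b'')]; ring
          _ ≤ c₁ * c₂ * (E * Real.exp (-(g * dX (σ (blk x)) (σ b'')))) :=
              mul_le_mul_of_nonneg_left
                (exp_two_legs (hd.nonneg _ _) (hd.nonneg _ _) (hd.triangle _ _ _) hδ' hg hga hgb) (mul_nonneg hT.1 hH.1)
          _ = c₁ * c₂ * E * Real.exp (-(g * dX (σ (blk x)) (σ b''))) := by ring
    _ = c₁ * c₂ * E * ∑ b'', Real.exp (-(g * dX (σ (blk x)) (σ b''))) := by rw [mul_sum]
    _ ≤ c₁ * c₂ * E * K g :=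
        mul_le_mul_of_nonneg_left (hK g hg _) (mul_nonneg (mul_nonneg hT.1 hH.1) (Real.exp_pos _).le)
    _ = c₁ * c₂ * K g * E := by ring

omit [DecidableEq ι] in
/-- **The Gram ∕ capacitance matrix entrywise**: `PosDecay ℋ ∧ ColCubeDecay ℋ ⇒ PosDecay (ℋᴴℋ)` on the blocks, constant
`c₁c₂K(g)` (N-reading: `1 · N^{dim} · K` — the natural size of `ℋᴴℋ`). [folklore] -/
theorem gram_posDecay (hd : IsPseudoDist dX) (hK0 : ∀ t, 0 < t → 0 ≤ K t) (hK : PosProfile dX σ K)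
    {H : Matrix ι κ ℝ} {c₁ c₂ δa δb : ℝ} (hH : PosDecay dX (σ ∘ blk) σ H c₁ δa) (hH' : ColCubeDecay dX blk σ H c₂ δb)
    {δ' g : ℝ} (hδ' : 0 ≤ δ') (hg : 0 < g) (hga : δ' + g ≤ δa) (hgb : δ' + g ≤ δb) :
    PosDecay dX σ σ (Hᴴ * H) (c₁ * c₂ * K g) δ' := by
  refine ⟨mul_nonneg (mul_nonneg hH.1 hH'.1) (hK0 g hg), fun b b' => ?_⟩
  set E : ℝ := Real.exp (-(δ' * dX (σ b) (σ b'))) with hE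
  have step1 : |(Hᴴ * H) b b'| ≤ ∑ b'', (c₁ * Real.exp (-(δa * dX (σ b'') (σ b))))
      * ∑ y ∈ univ.filter (fun y => blk y = b''), |H y b'| := by
    rw [Matrix.mul_apply]
    refine (abs_sum_le_sum_abs _ _).trans ?_
    rw [← Finset.sum_fiberwise univ blk]
    refine sum_le_sum fun b'' _ => ?_
    rw [mul_sum]
    refine sum_le_sum fun y hy => ?_
    have hyb : blk y = b'' := (mem_filter.mp hy).2
    rw [conjTranspose_apply, star_trivial, abs_mul]
    refine mul_le_mul_of_nonneg_right ?_ (abs_nonneg _)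
    have h := hH.2 y b
    rw [Function.comp_apply, hyb] at h
    exact h
  calc |(Hᴴ * H) b b'|
      ≤ ∑ b'', (c₁ * Real.exp (-(δa * dX (σ b'') (σ b)))) * ∑ y ∈ univ.filter (fun y => blk y = b''), |H y b'| := step1
    _ ≤ ∑ b'', c₁ * c₂ * E * Real.exp (-(g * dX (σ b) (σ b''))) := by
        refine sum_le_sum fun b'' _ => ?_
        calc (c₁ * Real.exp (-(δa * dX (σ b'') (σ b)))) * ∑ y ∈ univ.filter (fun y => blk y = b''), |H y b'|
            ≤ (c₁ * Real.exp (-(δa * dX (σ b'') (σ b)))) * (c₂ * Real.exp (-(δb * dX (σ b'') (σ b')))) :=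
              mul_le_mul_of_nonneg_left (hH'.2 b' b'') (mul_nonneg hH.1 (Real.exp_pos _).le)
          _ = c₁ * c₂ * (Real.exp (-(δa * dX (σ b) (σ b''))) * Real.exp (-(δb * dX (σ b'') (σ b')))) := by
              rw [hd.symm (σ b'') (σ b)]; ring
          _ ≤ c₁ * c₂ * (E * Real.exp (-(g * dX (σ b) (σ b'')))) :=
              mul_le_mul_of_nonneg_left
                (exp_two_legs (hd.nonneg _ _) (hd.nonneg _ _) (hd.triangle _ _ _) hδ' hg hga hgb) (mul_nonneg hH.1 hH'.1)
          _ = c₁ * c₂ * E * Real.exp (-(g * dX (σ b) (σ b''))) := by ring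
    _ = c₁ * c₂ * E * ∑ b'', Real.exp (-(g * dX (σ b) (σ b''))) := by rw [mul_sum]
    _ ≤ c₁ * c₂ * E * K g :=
        mul_le_mul_of_nonneg_left (hK g hg _) (mul_nonneg (mul_nonneg hH.1 hH'.1) (Real.exp_pos _).le)
    _ = c₁ * c₂ * K g * E := by ring

/-! ## §3 The sandwich in the cube currency and the transport to the squared form -/

/-- **DECAY OF `Γ·coproj ℋ·Γ` IN THE CUBE CURRENCY (N-sharp constants)**. [folklore] -/
theorem cubeDecay_sandwich_coproj (hd : IsPseudoDist dX) (hK0 : ∀ t, 0 < t → 0 ≤ K t) (hK : PosProfile dX σ K)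
    {Γ : Matrix ι ι ℝ} {ℋ : Matrix ι κ ℝ} {cΓ cH cH' δ γ : ℝ} (hδ : 0 < δ) (hγ : 0 < γ)
    (hΓ : CubeDecay dX blk σ Γ cΓ δ) (hℋ : PosDecay dX (σ ∘ blk) σ ℋ cH δ) (hℋ' : ColCubeDecay dX blk σ ℋ cH' δ)
    (hco : QGQInverse.Coercive (ℋᴴ * ℋ) γ) :
    CubeDecay dX blk σ (Γ * coproj ℋ * Γ)
      (cΓ * cΓ * K (δ / 2)
        + cΓ * cH * K (δ / 2) * (2 / γ) * K (rate K γ (cH * cH' * K (δ / 2)) (δ / 2) / 2) * cH'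
            * K (rate K γ (cH * cH' * K (δ / 2)) (δ / 2) / 4) * cΓ * K (rate K γ (cH * cH' * K (δ / 2)) (δ / 2) / 8))
      (rate K γ (cH * cH' * K (δ / 2)) (δ / 2) / 8) := by
  set δ₁ := rate K γ (cH * cH' * K (δ / 2)) (δ / 2) with hδ₁
  have hS : PosDecay dX σ σ (ℋᴴ * ℋ) (cH * cH' * K (δ / 2)) (δ / 2) :=
    gram_posDecay hd hK0 hK hℋ hℋ' (by positivity) (half_pos hδ) (by linarith) (by linarith)
  have hSi : PosDecay dX σ σ (ℋᴴ * ℋ)⁻¹ (2 / γ) δ₁ := B5Decay126.PosDecay.inv hd hK0 hK hγ (half_pos hδ) hS hco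
  have hδ₁pos : 0 < δ₁ := B4Sect5Torus.rate_pos hK0 hγ hS.1 (half_pos hδ)
  have hδ₁le : δ₁ ≤ δ / 2 / 4 := B4Sect5Torus.rate_le_quarter K γ _
  have h1 : PosDecay dX (σ ∘ blk) σ (Γ * ℋ) (cΓ * cH * K (δ / 2)) (δ / 2) :=
    hΓ.mul_posDecay hd hK0 hK hℋ (by positivity) (half_pos hδ) (by linarith) (by linarith)
  have h2 : PosDecay dX (σ ∘ blk) σ (Γ * ℋ * (ℋᴴ * ℋ)⁻¹) (cΓ * cH * K (δ / 2) * (2 / γ) * K (δ₁ / 2)) (δ₁ / 2) :=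
    B5Decay126.PosDecay.mul hd hK0 hK h1 hSi (by positivity) (half_pos hδ₁pos) (by linarith) (by linarith)
  have h3 : CubeDecay dX blk σ (Γ * ℋ * (ℋᴴ * ℋ)⁻¹ * ℋᴴ)
      (cΓ * cH * K (δ / 2) * (2 / γ) * K (δ₁ / 2) * cH' * K (δ₁ / 4)) (δ₁ / 4) :=
    posDecay_mul_colCube hd hK0 hK h2 hℋ' (by positivity) (by positivity : 0 < δ₁ / 4) (by linarith) (by linarith)
  have h4 : CubeDecay dX blk σ (Γ * ℋ * (ℋᴴ * ℋ)⁻¹ * ℋᴴ * Γ)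
      (cΓ * cH * K (δ / 2) * (2 / γ) * K (δ₁ / 2) * cH' * K (δ₁ / 4) * cΓ * K (δ₁ / 8)) (δ₁ / 8) :=
    h3.mul hd hK0 hK hΓ (by positivity) (by positivity : 0 < δ₁ / 8) (by linarith) (by linarith)
  have h0 : CubeDecay dX blk σ (Γ * Γ) (cΓ * cΓ * K (δ / 2)) (δ / 2) :=
    hΓ.mul hd hK0 hK hΓ (by positivity) (half_pos hδ) (by linarith) (by linarith)
  have halg : Γ * coproj ℋ * Γ = Γ * Γ - Γ * ℋ * (ℋᴴ * ℋ)⁻¹ * ℋᴴ * Γ := by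
    rw [coproj, Matrix.mul_sub, Matrix.mul_one, Matrix.sub_mul]
    simp only [Matrix.mul_assoc]
  rw [halg]
  exact h0.sub hd h4 (by linarith) le_rfl

/-- **CUBE DECAY OF THE LANDAU-GAUGE SCALAR OPERATOR FROM KING'S ONE-FORM OBJECTS** (R17 transport): real symmetric `L`,
`T`; `H_T = L + QᴴTQ`, its pivot and `QQᴴ` units; `(QQᴴ)⁻¹ ⪰ γ > 0`; `Γ = flucCov H_T Q` cube-decaying and
`ℋ = minimiser H_T Q` entrywise- and column-cube-decaying at rate `δ > 0` ⟹ `flucCov (L·L + QᴴT₂Q) Q` cube-decays at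
rate `δ₁/8` with the N-sharp constant of `cubeDecay_sandwich_coproj`. [folklore] -/
theorem cubeDecay_flucCov_sq (hd : IsPseudoDist dX) (hK0 : ∀ t, 0 < t → 0 ≤ K t) (hK : PosProfile dX σ K)
    {L : Matrix ι ι ℝ} {Q : Matrix κ ι ℝ} {T : Matrix κ κ ℝ} (hL : Lᴴ = L) (hT : Tᴴ = T)
    (hHT : IsUnit (L + Qᴴ * T * Q)) (hP : IsUnit (pivot (L + Qᴴ * T * Q) Q)) (hQ : IsUnit (Q * Qᴴ))
    {γ : ℝ} (hγ : 0 < γ) (hγQ : QGQInverse.Coercive (Q * Qᴴ)⁻¹ γ) {cΓ cH cH' δ : ℝ} (hδ : 0 < δ)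
    (hΓ : CubeDecay dX blk σ (flucCov (L + Qᴴ * T * Q) Q) cΓ δ)
    (hℋ : PosDecay dX (σ ∘ blk) σ (minimiser (L + Qᴴ * T * Q) Q) cH δ)
    (hℋ' : ColCubeDecay dX blk σ (minimiser (L + Qᴴ * T * Q) Q) cH' δ)
    (T₂ : Matrix κ κ ℝ) (hHT₂ : IsUnit (L * L + Qᴴ * T₂ * Q)) (hP₂ : IsUnit (pivot (L * L + Qᴴ * T₂ * Q) Q)) :
    CubeDecay dX blk σ (flucCov (L * L + Qᴴ * T₂ * Q) Q)
      (cΓ * cΓ * K (δ / 2)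
        + cΓ * cH * K (δ / 2) * (2 / γ) * K (rate K γ (cH * cH' * K (δ / 2)) (δ / 2) / 2) * cH'
            * K (rate K γ (cH * cH' * K (δ / 2)) (δ / 2) / 4) * cΓ * K (rate K γ (cH * cH' * K (δ / 2)) (δ / 2) / 8))
      (rate K γ (cH * cH' * K (δ / 2)) (δ / 2) / 8) := by
  have hHh : (L + Qᴴ * T * Q).IsHermitian := isHermitian_reg hL hT
  have hco : QGQInverse.Coercive ((minimiser (L + Qᴴ * T * Q) Q)ᴴ * minimiser (L + Qᴴ * T * Q) Q) γ :=
    fun x => (hγQ x).trans (gram_minimiser_form_ge hHh hP hQ x)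
  have hG : IsUnit ((minimiser (L + Qᴴ * T * Q) Q)ᴴ * minimiser (L + Qᴴ * T * Q) Q) :=
    QGQInverse.isUnit_of_coercive hγ hco
  rw [flucCov_sq_reg hL hT hHT hP hG T₂ hHT₂ hP₂]
  exact cubeDecay_sandwich_coproj hd hK0 hK hδ hγ hΓ hℋ hℋ' hco

end

end Summit.QuantumFields.BalabanUV.Beta.GAN24.WoodburyFibreGaugeCubeDecay
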